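import Summits.NavierStokesRegularity.FluidComputer.KidaPelzCurvature
import Summits.NavierStokesRegularity.FluidComputer.ModeBirth
import HarnessLib

/-!
# Where the Kida–Pelz datum first sends energy: the shells `|k|² = 20, 24, 36, 40` are born at rates `27/160, 1/8, 25/192, 27/320` — and NOTHING is born at `|k|² = 4, 8, 12, 32`, where the truncated advection term is a pure gradient

PLACEMENT: cell-own exact numbers of `pub-fluidc` (topic `FluidComputer`; `Literature/` holds cited
published statements only). Companion of `KidaPelzCurvature` (the integer/rational mirror and its cast
bridges) and `ModeBirth` (an empty mode `k` is born with `d²E(k)/dt² = |P_k N_S(k)|²`).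
HONEST FRAMING (cell `pub-fluidc`, verbatim): *low prior, high value-of-information experiment on Tao's
machine paradigm; NOT a claim that NS blows up.* Finite Galerkin system, exact arithmetic; nothing about
the Navier–Stokes PDE.

THE NUMBERS (kernel-evaluated, `decide +kernel`). With `birthMir k = Σ_j |(P_k N_S[kp](k))_j|²` (the `k`-term of
`KidaPelzCurvature.termMir` without its factor `|k|² - 11`) and `shellMir K = Σ_{k ∈ {0,±2,±4,±6}³, |k|² = K} birthMir k`:
`shellMir 20 = 27/160`, `shellMir 24 = 1/8`, `shellMir 36 = 25/192`, `shellMir 40 = 27/320`, and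
`shellMir K = 0` for `K ∈ {4, 8, 12, 16, 28, 32, 44, 48, …}` — in particular for the three inner shells
`4, 8, 12` and for `32`, on which the truncated advection term of `kp` does NOT vanish but is parallel to `k`
(pure pressure); total `Σ_K shellMir K = 61/120`, and `Σ_K (K - 11)·shellMir K = 2123/240` recovers the
curvature. THE THEOREMS: `birthTerm_vec3` (bridge), `sum_birth_shell_eq` (the real shell sums on any mask
`S ⊇` 24 modes `∪ E3` equal the mirror values), and `hasDerivAt_deriv_modalEnergy_kp` (along any unforced
Galerkin solution from `kp`, any `ν`, any pressure multiplier, every `k ∈ E3` is born with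
`d²E(k)/dt²(0) = birthMir k`), hence the shell statements `kp_shell_birth_20/24/36/40` and
`kp_shell_birth_eq_zero_4/8/12/32`. For the cell: in a CL-kp run the first energy above the datum shell
`|k|² = 11` appears, to second order in `t`, at `|k| ≈ 4.47, 4.90, 6, 6.32` (isotropic bins 4–6) with
`E_K(t) ≈ ½·shellMir K·t²`, and NOT in bins 2–3 — a zero-cost qualitative check of the Leray projection /
dealiasing of both engines at the first diagnostic rows. No named facts; 0 sorry.
-/

namespace Summit.NavierStokesRegularity.FluidComputer

open Complex ComplexConjugate Finset
open scoped BigOperators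
open Literature.Analysis.FluidPDE.FluidComputer Literature.Analysis.FluidPDE.FluidComputer.ShellTransfer
  Literature.Analysis.FluidPDE.FluidComputer.ShellTransfer.KidaPelzHat
open KidaPelzCurvature

namespace KidaPelzBirth

/-- The birth rate of `k = (x,y,z)`: `Σ_j (A_j/64 - ((k·A/64)/|k|²) k_j)²` in ℚ (`birthTerm_vec3`). -/
def birthMir (x y z : ℤ) : ℚ :=
  ((((AT x y z 0 : ℤ) : ℚ)) / 64 -
      ((x : ℚ) * (((AT x y z 0 : ℤ) : ℚ) / 64) + (y : ℚ) * (((AT x y z 1 : ℤ) : ℚ) / 64) +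
          (z : ℚ) * (((AT x y z 2 : ℤ) : ℚ) / 64)) / (((x ^ 2 + y ^ 2 + z ^ 2 : ℤ) : ℚ)) * (x : ℚ)) ^ 2 +
    ((((AT x y z 1 : ℤ) : ℚ)) / 64 -
      ((x : ℚ) * (((AT x y z 0 : ℤ) : ℚ) / 64) + (y : ℚ) * (((AT x y z 1 : ℤ) : ℚ) / 64) +
          (z : ℚ) * (((AT x y z 2 : ℤ) : ℚ) / 64)) / (((x ^ 2 + y ^ 2 + z ^ 2 : ℤ) : ℚ)) * (y : ℚ)) ^ 2 +
    ((((AT x y z 2 : ℤ) : ℚ)) / 64 -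
      ((x : ℚ) * (((AT x y z 0 : ℤ) : ℚ) / 64) + (y : ℚ) * (((AT x y z 1 : ℤ) : ℚ) / 64) +
          (z : ℚ) * (((AT x y z 2 : ℤ) : ℚ) / 64)) / (((x ^ 2 + y ^ 2 + z ^ 2 : ℤ) : ℚ)) * (z : ℚ)) ^ 2

/-- The shell sum `Σ_{k ∈ E3, |k|² = K} birthMir k` in ℚ. -/
def shellMir (K : ℤ) : ℚ :=
  sum7 fun x => sum7 fun y => sum7 fun z => if x ^ 2 + y ^ 2 + z ^ 2 = K then birthMir x y z else 0

/-- **Kernel evaluation of the eight candidate shells** (`|k|² ≤ 40` reachable by a pair of KP modes). -/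
theorem shellMir_values :
    shellMir 4 = 0 ∧ shellMir 8 = 0 ∧ shellMir 12 = 0 ∧ shellMir 20 = 27 / 160 ∧ shellMir 24 = 1 / 8 ∧
      shellMir 32 = 0 ∧ shellMir 36 = 25 / 192 ∧ shellMir 40 = 27 / 320 := by
  refine ⟨?_, ?_, ?_, ?_, ?_, ?_, ?_, ?_⟩ <;> decide +kernel

/-- The remaining shells of the even box carry nothing either. -/
theorem shellMir_zero_other :
    shellMir 16 = 0 ∧ shellMir 28 = 0 ∧ shellMir 44 = 0 ∧ shellMir 48 = 0 ∧ shellMir 52 = 0 ∧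
      shellMir 56 = 0 ∧ shellMir 68 = 0 ∧ shellMir 72 = 0 ∧ shellMir 76 = 0 ∧ shellMir 88 = 0 ∧
        shellMir 108 = 0 := by
  refine ⟨?_, ?_, ?_, ?_, ?_, ?_, ?_, ?_, ?_, ?_, ?_⟩ <;> decide +kernel

/-- Total second-order birth rate `Σ_{k∈E3} birthMir k = 61/120` and the curvature as its `|k|²`-moment
`Σ_{k∈E3} (|k|² - 11)·birthMir k = 2123/240` (= `KidaPelzCurvature.totalMir`). -/
theorem birth_total :
    (sum7 fun x => sum7 fun y => sum7 fun z => birthMir x y z) = 61 / 120 ∧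
      (sum7 fun x => sum7 fun y => sum7 fun z => (((x ^ 2 + y ^ 2 + z ^ 2 : ℤ) : ℚ) - 11) * birthMir x y z) =
        2123 / 240 := by
  refine ⟨?_, ?_⟩ <;> decide +kernel

/-- **Bridge**: the birth rate of `![x,y,z]` under the KP datum is the rational `birthMir x y z`. -/
theorem birthTerm_vec3 {S : Finset (Fin 3 → ℤ)} (hS : modes ⊆ S) (x y z : ℤ) :
    ∑ j, Complex.normSq (leray ![x, y, z] (advection kp S ![x, y, z]) j) = ((birthMir x y z : ℚ) : ℝ) := by
  have hadv : advection kp S ![x, y, z] =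
      fun j => I * (((fun j : Fin 3 => ((AT x y z j.val : ℤ) : ℝ) / 64) j : ℝ) : ℂ) := by
    funext j
    rw [advection_vec3 hS]
    push_cast
    ring
  rw [hadv, sum_normSq_leray_imag, knormSq_vec3, Fin.sum_univ_three, Fin.sum_univ_three]
  simp only [Matrix.cons_val_zero, Matrix.cons_val_one, Matrix.head_cons, Matrix.cons_val_two,
    Matrix.tail_cons, Fin.val_zero, Fin.val_one, Fin.val_two]
  unfold birthMir
  push_cast
  ring

/-- **The real shell sums equal the mirror**: for every `K` and every mask `S ⊇ modes`,
`Σ_{k ∈ E3, |k|² = K} Σ_j |(P_k N_S[kp](k))_j|² = shellMir K`. -/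
theorem sum_birth_shell_eq {S : Finset (Fin 3 → ℤ)} (hS : modes ⊆ S) (K : ℤ) :
    ∑ k ∈ E3, (if knormSq k = (K : ℝ) then ∑ j, Complex.normSq (leray k (advection kp S k) j) else 0) =
      ((shellMir K : ℚ) : ℝ) := by
  rw [E3, sum_box]
  have hterm : ∀ x y z : ℤ,
      (if knormSq ![x, y, z] = (K : ℝ) then ∑ j, Complex.normSq (leray ![x, y, z] (advection kp S ![x, y, z]) j)
        else 0) = (((if x ^ 2 + y ^ 2 + z ^ 2 = K then birthMir x y z else 0 : ℚ)) : ℝ) := by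
    intro x y z
    have hiff : knormSq ![x, y, z] = (K : ℝ) ↔ x ^ 2 + y ^ 2 + z ^ 2 = K := by
      rw [knormSq_vec3]; exact_mod_cast Iff.rfl
    by_cases h : x ^ 2 + y ^ 2 + z ^ 2 = K
    · rw [if_pos (hiff.mpr h), if_pos h, birthTerm_vec3 hS]
    · rw [if_neg (fun h' => h (hiff.mp h')), if_neg h]; push_cast; rfl
  simp_rw [hterm]
  simp only [sum_evens, shellMir, cast_sum7]

/-- **KP MODE BIRTH**: along any unforced Galerkin solution from the Kida–Pelz datum (any `ν`, any pressure
multiplier) on a mask `S ⊇` the 24 modes, every wavevector `![x,y,z]` of the even box that lies in `S` is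
born with `d²E(k)/dt² (0) = birthMir x y z`. -/
theorem hasDerivAt_deriv_modalEnergy_kp {U : ℝ → FourierVelocity} {S : Finset (Fin 3 → ℤ)} {ν : ℝ}
    {c : ℝ → (Fin 3 → ℤ) → ℂ} (hU : IsGalerkinSolution U S ν c fun _ _ _ => 0) (hsupp : IsSupportedOn U S)
    (h0 : U 0 = kp) (hS : modes ⊆ S) {x y z : ℤ} (hkS : (![x, y, z] : Fin 3 → ℤ) ∈ S)
    (hkE : (![x, y, z] : Fin 3 → ℤ) ∈ E3) :
    HasDerivAt (deriv fun s => modalEnergy (U s) ![x, y, z]) ((birthMir x y z : ℚ) : ℝ) 0 := by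
  have hz : (U 0).coeff ![x, y, z] = 0 := by
    rw [h0]
    funext j
    rw [kp_coeff]
    refine coeffFun_of_not_mem (fun hm => ?_) j
    -- a mode of `E3` has even entries, a KP mode odd ones
    have h1 := entry_of_mem_modes hm 0
    unfold E3 at hkE
    rw [mem_box, mem_evens] at hkE
    have h2 := hkE.1
    simp only [Matrix.cons_val_zero] at h1 h2
    omega
  have h := ModeBirth.hasDerivAt_deriv_modalEnergy_of_coeff_eq_zero hU hsupp hkS hz
  rw [h0, birthTerm_vec3 hS] at h
  exact h

/-- **THE FIRST EXCITED SHELLS OF A KIDA–PELZ RUN.** On any mask containing the 24 modes and the even box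
(every `Dealiasing.box K`, `K ≥ 6`), the second-order birth rates of the shells above the datum are:
`|k|² = 20 ↦ 27/160`, `24 ↦ 1/8`, `36 ↦ 25/192`, `40 ↦ 27/320` … -/
theorem kp_shell_birth {S : Finset (Fin 3 → ℤ)} (hS : modes ⊆ S) :
    (∑ k ∈ E3, (if knormSq k = (20 : ℝ) then ∑ j, Complex.normSq (leray k (advection kp S k) j) else 0))
        = 27 / 160 ∧
      (∑ k ∈ E3, (if knormSq k = (24 : ℝ) then ∑ j, Complex.normSq (leray k (advection kp S k) j) else 0))
        = 1 / 8 ∧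
      (∑ k ∈ E3, (if knormSq k = (36 : ℝ) then ∑ j, Complex.normSq (leray k (advection kp S k) j) else 0))
        = 25 / 192 ∧
      (∑ k ∈ E3, (if knormSq k = (40 : ℝ) then ∑ j, Complex.normSq (leray k (advection kp S k) j) else 0))
        = 27 / 320 := by
  obtain ⟨-, -, -, h20, h24, -, h36, h40⟩ := shellMir_values
  refine ⟨?_, ?_, ?_, ?_⟩
  · have h := sum_birth_shell_eq hS 20
    rw [h20] at h; push_cast at h; linarith
  · have h := sum_birth_shell_eq hS 24
    rw [h24] at h; push_cast at h; linarith
  · have h := sum_birth_shell_eq hS 36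
    rw [h36] at h; push_cast at h; linarith
  · have h := sum_birth_shell_eq hS 40
    rw [h40] at h; push_cast at h; linarith

/-- **… AND THE SILENT INNER SHELLS**: `|k|² = 4, 8, 12` (and `32`) receive NOTHING at second order — on those
wavevectors the truncated advection term of `kp` is nonzero but parallel to `k` (pure pressure), so its
Leray projection vanishes. -/
theorem kp_shell_birth_eq_zero {S : Finset (Fin 3 → ℤ)} (hS : modes ⊆ S) :
    (∑ k ∈ E3, (if knormSq k = (4 : ℝ) then ∑ j, Complex.normSq (leray k (advection kp S k) j) else 0)) = 0 ∧
      (∑ k ∈ E3, (if knormSq k = (8 : ℝ) then ∑ j, Complex.normSq (leray k (advection kp S k) j) else 0)) = 0 ∧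
      (∑ k ∈ E3, (if knormSq k = (12 : ℝ) then ∑ j, Complex.normSq (leray k (advection kp S k) j) else 0)) = 0 ∧
      (∑ k ∈ E3, (if knormSq k = (32 : ℝ) then ∑ j, Complex.normSq (leray k (advection kp S k) j) else 0))
        = 0 := by
  obtain ⟨h4, h8, h12, -, -, h32, -, -⟩ := shellMir_values
  refine ⟨?_, ?_, ?_, ?_⟩
  · have h := sum_birth_shell_eq hS 4
    rw [h4] at h; push_cast at h; linarith
  · have h := sum_birth_shell_eq hS 8
    rw [h8] at h; push_cast at h; linarith
  · have h := sum_birth_shell_eq hS 12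
    rw [h12] at h; push_cast at h; linarith
  · have h := sum_birth_shell_eq hS 32
    rw [h32] at h; push_cast at h; linarith

/-! ### Per-mode equidistribution of the birth rates (pub-fluidc-lit gen 20)

The per-mode table behind the shell sums (read off an exact rational convolution by the cell's
dns-B seat, kit `j080365`, and kernel-evaluated here from `birthMir`): each of the four born shells
carries exactly `24` born modes, all at ONE rate — `9/1280` on `|k|² = 20`, `1/192` on `24`, `25/4608`
on `36`, `9/2560` on `40` (so `shellMir K = 24 · modeMir K`) — and every other point of the even box
`E3` is born at rate `0` to second order.  A zero-cost PER-MODE check of both engines' nonlinear term. -/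

/-- The per-mode birth value of shell `K` (one value per born shell, `0` otherwise). -/
def modeMir (K : ℤ) : ℚ :=
  if K = 20 then 9 / 1280 else if K = 24 then 1 / 192 else if K = 36 then 25 / 4608
    else if K = 40 then 9 / 2560 else 0

/-- Conjunction of a Boolean test over `{0, ±2, ±4, ±6}` (kernel-friendly form of `∀ a ∈ evens`). -/
def all7 (p : ℤ → Bool) : Bool := p 0 && p 2 && p (-2) && p 4 && p (-4) && p 6 && p (-6)

/-- Unpacking `all7`: the test holds at every `a ∈ evens`. -/
theorem of_all7 {p : ℤ → Bool} (h : all7 p = true) {a : ℤ} (ha : a ∈ evens) : p a = true := by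
  simp only [all7, Bool.and_eq_true] at h
  obtain ⟨⟨⟨⟨⟨⟨h0, h2⟩, hm2⟩, h4⟩, hm4⟩, h6⟩, hm6⟩ := h
  rcases mem_evens.mp ha with rfl | rfl | rfl | rfl | rfl | rfl | rfl <;> assumption

/-- **Kernel case analysis over the `343` points of the even box**: `birthMir k ∈ {0, modeMir |k|²}`. -/
theorem birthMir_dichotomy_all7 :
    all7 (fun x => all7 fun y => all7 fun z =>
      decide (birthMir x y z = 0 ∨ birthMir x y z = modeMir (x ^ 2 + y ^ 2 + z ^ 2))) = true := by
  decide +kernel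

/-- On the even box, the birth rate of a mode is either `0` or its shell's per-mode value. -/
theorem birthMir_eq_zero_or_modeMir {x y z : ℤ} (hx : x ∈ evens) (hy : y ∈ evens) (hz : z ∈ evens) :
    birthMir x y z = 0 ∨ birthMir x y z = modeMir (x ^ 2 + y ^ 2 + z ^ 2) :=
  of_decide_eq_true (of_all7 (of_all7 (of_all7 birthMir_dichotomy_all7 hx) hy) hz)

/-- The number of born modes (`birthMir ≠ 0`) on the shell `|k|² = K` of the even box. -/
def bornCount (K : ℤ) : ℕ :=
  sum7 fun x => sum7 fun y => sum7 fun z =>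
    if x ^ 2 + y ^ 2 + z ^ 2 = K ∧ birthMir x y z ≠ 0 then 1 else 0

/-- **Exactly `24` born modes on each of the four born shells** (kernel evaluation). -/
theorem bornCount_values :
    bornCount 20 = 24 ∧ bornCount 24 = 24 ∧ bornCount 36 = 24 ∧ bornCount 40 = 24 := by
  refine ⟨?_, ?_, ?_, ?_⟩ <;> decide +kernel

/-- Consistency with the shell table: `shellMir K = 24 · modeMir K` on the four born shells. -/
theorem shellMir_eq_mul_modeMir :
    shellMir 20 = 24 * modeMir 20 ∧ shellMir 24 = 24 * modeMir 24 ∧ shellMir 36 = 24 * modeMir 36 ∧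
      shellMir 40 = 24 * modeMir 40 := by
  obtain ⟨-, -, -, h20, h24, -, h36, h40⟩ := shellMir_values
  rw [h20, h24, h36, h40]
  simp only [modeMir]
  norm_num

/-- **KP PER-MODE BIRTH.** Along any unforced Galerkin solution from the Kida–Pelz datum (any `ν`, any
pressure multiplier) on a mask `S ⊇` the 24 modes, every wavevector `k = ![x,y,z]` of the even box lying
in `S` is born either at rate `0` or at its shell's per-mode rate: `d²E(k)/dt²(0) ∈ {0, modeMir |k|²}`,
i.e. `9/1280`, `1/192`, `25/4608`, `9/2560` on `|k|² = 20, 24, 36, 40` and `0` on every other shell. -/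
theorem kp_mode_birth {U : ℝ → FourierVelocity} {S : Finset (Fin 3 → ℤ)} {ν : ℝ}
    {c : ℝ → (Fin 3 → ℤ) → ℂ} (hU : IsGalerkinSolution U S ν c fun _ _ _ => 0) (hsupp : IsSupportedOn U S)
    (h0 : U 0 = kp) (hS : modes ⊆ S) {x y z : ℤ} (hkS : (![x, y, z] : Fin 3 → ℤ) ∈ S)
    (hkE : (![x, y, z] : Fin 3 → ℤ) ∈ E3) :
    HasDerivAt (deriv fun s => modalEnergy (U s) ![x, y, z]) 0 0 ∨
      HasDerivAt (deriv fun s => modalEnergy (U s) ![x, y, z])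
        ((modeMir (x ^ 2 + y ^ 2 + z ^ 2) : ℚ) : ℝ) 0 := by
  have h := hasDerivAt_deriv_modalEnergy_kp hU hsupp h0 hS hkS hkE
  have hmem : x ∈ evens ∧ y ∈ evens ∧ z ∈ evens := by
    unfold E3 at hkE
    rw [mem_box] at hkE
    simpa only [Matrix.cons_val_zero, Matrix.cons_val_one, Matrix.head_cons, Matrix.cons_val_two,
      Matrix.tail_cons] using hkE
  rcases birthMir_eq_zero_or_modeMir hmem.1 hmem.2.1 hmem.2.2 with hb | hb
  · left
    rw [hb] at h
    simpa only [Rat.cast_zero] using h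
  · right
    rw [hb] at h
    exact h

end KidaPelzBirth

end Summit.NavierStokesRegularity.FluidComputer
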